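import Summits.BirchSwinnertonDyer.BirchSwinnertonDyer.Theorems.SignedLowerHalvesSprungLowerDivisibilityAtThreeSlopeSeparation
import HarnessLib

/-!
# Crux `SprungLowerDivisibilityAtThree` (item stmt-BirchSwinnertonDyer-19875), line `chromatic-common-zeros`:
# the GENERAL one-segment Newton polygon in `Λ = ℤ_p⟦T⟧` — if the coefficients below `λ(G)` lie on or
# above the chord from `(0, v(G_0))` to `(λ(G), 0)`, every zero of `G` in the open disc has
# `|z|^{λ(G)} = |G_0|`; slope separation and coprimality for two such elements (any leading valuation)

Cell `bsd-ssimc` (host) / lead `cruxlead-stmt-BirchSwinnertonDyer-19875`; width seat `-w3` (gen 3);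
`--supports` 19875 `--as helper`; THEOREMS ONLY (pure `p`-adic algebra, general `p`; no definition, no named
fact, nothing about any curve asserted); closes no item; BSD / K1 / leaf X8 are NOT proved by anything here.

Sequel of `…SlopeSeparation.lean` (p624687), whose §2–§4 treat the leading valuation `v(G_0) = 1`, where
the chord condition is automatic. For the x8 census (R5 table `x8_r5_chromatic_n5_j299803.tsv`) the
general form reaches the 22 further cells whose two chromatic `3`-adic `L`-functions have ONE-SEGMENT
Newton polygons of DIFFERENT slopes with leading valuation `≥ 2` (e.g. slopes `1,1,1,1` against `2,2`),
at the price of per-pair LOWER BOUNDS on the valuations of the intermediate coefficients (the chord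
condition below), which the x8 engines already compute.

## What is proved (`G(z) = ∑ ι(G_k) z^k`, `|z| < 1` in `ℂ_p`; `c := |G_0|`, `λ := λ(G)`, `μ(G) = 0`)

* §1 `norm_tsum_eq_of_dominant` — the isolated-dominant-term principle for the evaluation series: if one
  term `ι(G_{k₀}) z^{k₀}` has absolute value `> δ ≥` that of every other term, then `|G(z)|` is its
  absolute value.
* §2 THE CHORD CONDITION `∀ 0 < k < λ, |G_k|^λ ≤ c^{λ−k}` (the point `(k, v(G_k))` lies on or above the
  segment from `(0, v(G_0))` to `(λ, 0)`): then `|z|^λ > c ⟹ |G(z)| = |z|^λ`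
  (`norm_tsum_eq_pow_lam_of_chord`), `|z|^λ < c ⟹ |G(z)| = c` (`norm_tsum_eq_norm_constantCoeff_of_chord`),
  hence **every zero in the open disc has `|z|^λ = c`** (`norm_pow_lam_eq_of_hasSum_zero_of_chord`).
* §3 two functions `F, G` with the chord condition, `μ = 0`, nonzero constant terms and
  **`|F_0|^{λ(G)} ≠ |G_0|^{λ(F)}`** (different slopes `v(F_0)/λ(F) ≠ v(G_0)/λ(G)`): no common zero
  (`not_common_zero_of_chord`), hence **no common height-one prime of `Λ`**
  (`not_mem_and_mem_of_chord`), and the `T`-shifted form off `(T)` (`not_mem_and_mem_of_X_mul_of_chord`).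

References (ATTRIBUTION): [Koblitz1984] N. Koblitz, *p-adic Numbers, p-adic Analysis, and Zeta-Functions*,
GTM 58, Ch. IV §3–§4 (Newton polygon of a power series; the number of zeros of valuation `s` is the
horizontal length of the segment of slope `−s`); [Washington1997] §7.1–7.2, Thm. 7.3, §13.2;
[Lang1990] Ch. 5 §2. Tree: `…SlopeSeparation.lean` §1/§4, `Rank1Residual/Iwasawa/LambdaInvariant*`,
`Literature/…/PAdicPowerSeriesZeros.lean`.
-/

set_option autoImplicit false
-- justification: the mandated namespace `Summit.BirchSwinnertonDyer.BirchSwinnertonDyer.Theorems`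
-- (single-conjunct summit, Sub = Summit) repeats a segment by design (D-0017).
set_option linter.dupNamespace false

noncomputable section

open scoped Classical

open Polynomial Literature.NumberTheory.EllipticCurves
  Summit.BirchSwinnertonDyer.Rank1Residual.X1.MuLambda
  Summit.BirchSwinnertonDyer.Rank1Residual.Iwasawa

namespace Summit.BirchSwinnertonDyer.BirchSwinnertonDyer.Theorems.ChromaticSlopeSeparation

variable {p : ℕ} [hp : Fact p.Prime]

/-! ## §1. The isolated dominant term -/

section Dominant

/-- **Isolated dominant term.** For `G ∈ Λ`, `|z| < 1`, an index `k₀` and `δ < |ι(G_{k₀}) z^{k₀}|` bounding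
every OTHER term: `|G(z)| = |ι(G_{k₀}) z^{k₀}|` (ultrametric equality for a convergent series).
[cite: Koblitz1984, Ch. IV §4 (Newton polygon of a power series)] -/
theorem norm_tsum_eq_of_dominant (G : IwasawaAlgebra p) {z : ℂ_[p]} (hz : ‖z‖ < 1) (k₀ : ℕ) {δ : ℝ}
    (hδ0 : 0 ≤ δ)
    (hδ : δ < ‖((algebraMap ℚ_[p] ℂ_[p]).comp (algebraMap ℤ_[p] ℚ_[p])) (PowerSeries.coeff k₀ G) * z ^ k₀‖)
    (hother : ∀ k, k ≠ k₀ →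
      ‖((algebraMap ℚ_[p] ℂ_[p]).comp (algebraMap ℤ_[p] ℚ_[p])) (PowerSeries.coeff k G) * z ^ k‖ ≤ δ) :
    ‖∑' k, ((algebraMap ℚ_[p] ℂ_[p]).comp (algebraMap ℤ_[p] ℚ_[p])) (PowerSeries.coeff k G) * z ^ k‖ =
      ‖((algebraMap ℚ_[p] ℂ_[p]).comp (algebraMap ℤ_[p] ℚ_[p])) (PowerSeries.coeff k₀ G) * z ^ k₀‖ := by
  set ιZ : ℤ_[p] →+* ℂ_[p] := (algebraMap ℚ_[p] ℂ_[p]).comp (algebraMap ℤ_[p] ℚ_[p]) with hιZ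
  set a : ℕ → ℂ_[p] := fun k ↦ ιZ (PowerSeries.coeff k G) * z ^ k with ha
  have hsum : Summable a := summable_map_coeff_mul_pow ιZ (norm_algebraMap_coeff_le_one G) hz
  have hrest : ‖∑' k, ite (k = k₀) 0 (a k)‖ ≤ δ := by
    refine IsUltrametricDist.norm_tsum_le_of_forall_le_of_nonneg hδ0 fun k ↦ ?_
    by_cases hk : k = k₀
    · rw [if_pos hk, norm_zero]; exact hδ0
    · rw [if_neg hk]; exact hother k hk
  have hne : ‖a k₀‖ ≠ ‖∑' k, ite (k = k₀) 0 (a k)‖ := (ne_of_lt (lt_of_le_of_lt hrest hδ)).symm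
  change ‖∑' k, a k‖ = ‖a k₀‖
  rw [hsum.tsum_eq_add_tsum_ite k₀, IsUltrametricDist.norm_add_eq_max_of_norm_ne_norm hne]
  exact max_eq_left (le_trans hrest hδ.le)

end Dominant

/-! ## §2. One function under the chord condition -/

section Chord

/-- **Above the critical radius the top term dominates.** `G ≠ 0`, `μ(G) = 0`, chord condition, `|z| < 1`
and `|z|^{λ(G)} > |G_0|` give `|G(z)| = |z|^{λ(G)}`: the term `k = λ` has absolute value `|z|^λ` (unit
coefficient); a term `0 < k < λ` has `(|G_k||z|^k)^λ ≤ |G_0|^{λ−k}|z|^{kλ} < |z|^{λ(λ−k)}|z|^{kλ}`, i.e.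
absolute value `< |z|^λ`; the term `0` has `|G_0| < |z|^λ`; a term `k > λ` has `≤ |z|^{λ+1}`.
[cite: Koblitz1984, Ch. IV §4 (Newton polygon of a power series)] [cite: Washington1997, §7.1–7.2] -/
theorem norm_tsum_eq_pow_lam_of_chord {G : IwasawaAlgebra p} (hG0 : G ≠ 0) (hμ : mu G = 0)
    (hchord : ∀ k, 0 < k → k < lam G →
      ‖PowerSeries.coeff k G‖ ^ lam G ≤ ‖PowerSeries.constantCoeff G‖ ^ (lam G - k))
    {z : ℂ_[p]} (hz : ‖z‖ < 1) (hgt : ‖PowerSeries.constantCoeff G‖ < ‖z‖ ^ lam G) :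
    ‖∑' k, ((algebraMap ℚ_[p] ℂ_[p]).comp (algebraMap ℤ_[p] ℚ_[p])) (PowerSeries.coeff k G) *
        z ^ k‖ = ‖z‖ ^ lam G := by
  set ιZ : ℤ_[p] →+* ℂ_[p] := (algebraMap ℚ_[p] ℂ_[p]).comp (algebraMap ℤ_[p] ℚ_[p]) with hιZ
  set c : ℝ := ‖PowerSeries.constantCoeff G‖ with hc
  set s : ℝ := ‖z‖ with hs
  have hc0 : 0 ≤ c := norm_nonneg _
  have hs0 : 0 ≤ s := norm_nonneg _
  have hsl0 : 0 < s ^ lam G := lt_of_le_of_lt hc0 hgt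
  have hspos : 0 < s := by
    rcases Nat.eq_zero_or_pos (lam G) with h0 | hpos
    · -- `λ = 0`: the constant coefficient is a unit, `c = 1 < s^0 = 1` is absurd
      exfalso
      have h1 := norm_coeff_lam_eq_one hG0 hμ
      rw [h0, norm_coeff_zero_eq] at h1
      rw [h0, pow_zero] at hgt
      exact absurd hgt (by rw [hc, h1]; exact lt_irrefl _)
    · by_contra hle
      rw [not_lt] at hle
      have : s = 0 := le_antisymm hle hs0
      rw [this, zero_pow hpos.ne'] at hsl0
      exact lt_irrefl _ hsl0
  -- the norm of the top term
  have htop : ‖ιZ (PowerSeries.coeff (lam G) G) * z ^ lam G‖ = s ^ lam G := by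
    rw [norm_mul, norm_pow, hιZ, norm_coeff_lam_eq_one hG0 hμ, one_mul]
  -- a uniform bound `δ < s^λ` for the other terms: the finitely many `k < λ` and the tail `s^{λ+1}`
  have hfin : ∀ k, k < lam G → ‖ιZ (PowerSeries.coeff k G) * z ^ k‖ < s ^ lam G := by
    intro k hk
    rw [norm_mul, norm_pow, hιZ, norm_algebraMap_comp_apply]
    rcases Nat.eq_zero_or_pos k with rfl | hkpos
    · rw [pow_zero, mul_one, PowerSeries.coeff_zero_eq_constantCoeff_apply]; exact hgt
    · -- `(|G_k| s^k)^λ < (s^λ)^λ`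
      have hlampos : 0 < lam G := lt_of_le_of_lt (Nat.zero_le _) hk
      refine lt_of_pow_lt_pow_left₀ (lam G) (pow_nonneg hs0 _) ?_
      have h1 : ‖PowerSeries.coeff k G‖ ^ lam G ≤ c ^ (lam G - k) := hchord k hkpos hk
      have h2 : c ^ (lam G - k) < (s ^ lam G) ^ (lam G - k) :=
        pow_lt_pow_left₀ hgt hc0 (by omega)
      calc (‖PowerSeries.coeff k G‖ * s ^ k) ^ lam G
          = ‖PowerSeries.coeff k G‖ ^ lam G * (s ^ k) ^ lam G := mul_pow _ _ _
        _ < (s ^ lam G) ^ (lam G - k) * (s ^ k) ^ lam G :=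
            mul_lt_mul_of_pos_right (lt_of_le_of_lt h1 h2) (pow_pos (pow_pos hspos _) _)
        _ = (s ^ lam G) ^ lam G := by
            rw [← pow_mul, ← pow_mul, ← pow_mul, ← pow_add]
            congr 1
            rw [mul_comm k (lam G), ← Nat.mul_add, Nat.sub_add_cancel hk.le]
  -- the maximum of the finitely many lower terms
  obtain ⟨δ₁, hδ₁lt, hδ₁⟩ : ∃ δ₁ : ℝ, δ₁ < s ^ lam G ∧
      ∀ k, k < lam G → ‖ιZ (PowerSeries.coeff k G) * z ^ k‖ ≤ δ₁ := by
    rcases Nat.eq_zero_or_pos (lam G) with h0 | hpos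
    · exact ⟨0, hsl0, fun k hk ↦ absurd hk (by rw [h0]; exact Nat.not_lt_zero k)⟩
    · have hne : (Finset.range (lam G)).Nonempty := ⟨0, Finset.mem_range.mpr hpos⟩
      obtain ⟨k₁, hk₁, hmax⟩ := Finset.exists_max_image (Finset.range (lam G))
        (fun k ↦ ‖ιZ (PowerSeries.coeff k G) * z ^ k‖) hne
      exact ⟨_, hfin k₁ (Finset.mem_range.mp hk₁), fun k hk ↦ hmax k (Finset.mem_range.mpr hk)⟩
  set δ : ℝ := max δ₁ (s ^ (lam G + 1)) with hδ
  have hδlt : δ < s ^ lam G := by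
    refine max_lt hδ₁lt ?_
    calc s ^ (lam G + 1) = s ^ lam G * s := pow_succ _ _
      _ < s ^ lam G * 1 := mul_lt_mul_of_pos_left hz hsl0
      _ = s ^ lam G := mul_one _
  have hδ0 : 0 ≤ δ := le_trans (pow_nonneg hs0 _) (le_max_right _ _)
  rw [← htop]
  refine norm_tsum_eq_of_dominant G hz (lam G) hδ0 (by rw [htop]; exact hδlt) fun k hk ↦ ?_
  rcases lt_or_gt_of_ne hk with hlt | hgt'
  · exact le_trans (hδ₁ k hlt) (le_max_left _ _)
  · rw [norm_mul, norm_pow]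
    calc ‖ιZ (PowerSeries.coeff k G)‖ * s ^ k ≤ 1 * s ^ (lam G + 1) :=
          mul_le_mul (norm_algebraMap_coeff_le_one G k) (pow_le_pow_of_le_one hs0 hz.le hgt')
            (pow_nonneg hs0 _) zero_le_one
      _ = s ^ (lam G + 1) := one_mul _
      _ ≤ δ := le_max_right _ _

/-- **Below the critical radius the constant term dominates.** The chord condition (no hypothesis on
`μ` needed here), `|z| < 1` and `|z|^{λ(G)} < |G_0|` give `|G(z)| = |G_0|`: a term `0 < k < λ` has
`(|G_k||z|^k)^λ ≤ |G_0|^{λ−k}(|z|^λ)^k < |G_0|^λ`; a term `k ≥ λ` has `≤ |z|^λ < |G_0|`.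
[cite: Koblitz1984, Ch. IV §4 (Newton polygon of a power series)] [cite: Washington1997, §7.1–7.2] -/
theorem norm_tsum_eq_norm_constantCoeff_of_chord {G : IwasawaAlgebra p}
    (hchord : ∀ k, 0 < k → k < lam G →
      ‖PowerSeries.coeff k G‖ ^ lam G ≤ ‖PowerSeries.constantCoeff G‖ ^ (lam G - k))
    {z : ℂ_[p]} (hz : ‖z‖ < 1) (hlt : ‖z‖ ^ lam G < ‖PowerSeries.constantCoeff G‖) :
    ‖∑' k, ((algebraMap ℚ_[p] ℂ_[p]).comp (algebraMap ℤ_[p] ℚ_[p])) (PowerSeries.coeff k G) *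
        z ^ k‖ = ‖PowerSeries.constantCoeff G‖ := by
  set ιZ : ℤ_[p] →+* ℂ_[p] := (algebraMap ℚ_[p] ℂ_[p]).comp (algebraMap ℤ_[p] ℚ_[p]) with hιZ
  set c : ℝ := ‖PowerSeries.constantCoeff G‖ with hc
  set s : ℝ := ‖z‖ with hs
  have hs0 : 0 ≤ s := norm_nonneg _
  have hcpos : 0 < c := lt_of_le_of_lt (pow_nonneg hs0 _) hlt
  have hlampos : 0 < lam G := by
    rcases Nat.eq_zero_or_pos (lam G) with h0 | hpos
    · exfalso
      rw [h0, pow_zero] at hlt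
      exact absurd (lt_of_lt_of_le hlt (PadicInt.norm_le_one _)) (lt_irrefl _)
    · exact hpos
  have hbot : ‖ιZ (PowerSeries.coeff 0 G) * z ^ 0‖ = c := by
    rw [pow_zero, mul_one, hιZ, norm_coeff_zero_eq]
  -- every other term is `< c`; uniform bound `δ = max(max over 0<k<λ, s^λ)`
  have hfin : ∀ k, 0 < k → k < lam G → ‖ιZ (PowerSeries.coeff k G) * z ^ k‖ < c := by
    intro k hkpos hk
    rw [norm_mul, norm_pow, hιZ, norm_algebraMap_comp_apply]
    refine lt_of_pow_lt_pow_left₀ (lam G) hcpos.le ?_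
    have h1 : ‖PowerSeries.coeff k G‖ ^ lam G ≤ c ^ (lam G - k) := hchord k hkpos hk
    have h2 : (s ^ k) ^ lam G < c ^ k := by
      rw [← pow_mul, mul_comm, pow_mul]
      exact pow_lt_pow_left₀ hlt (pow_nonneg hs0 _) hkpos.ne'
    calc (‖PowerSeries.coeff k G‖ * s ^ k) ^ lam G
        = ‖PowerSeries.coeff k G‖ ^ lam G * (s ^ k) ^ lam G := mul_pow _ _ _
      _ ≤ c ^ (lam G - k) * (s ^ k) ^ lam G :=
          mul_le_mul_of_nonneg_right h1 (pow_nonneg (pow_nonneg hs0 _) _)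
      _ < c ^ (lam G - k) * c ^ k := mul_lt_mul_of_pos_left h2 (pow_pos hcpos _)
      _ = c ^ lam G := by rw [← pow_add, Nat.sub_add_cancel hk.le]
  obtain ⟨δ₁, hδ₁lt, hδ₁0, hδ₁⟩ : ∃ δ₁ : ℝ, δ₁ < c ∧ 0 ≤ δ₁ ∧
      ∀ k, 0 < k → k < lam G → ‖ιZ (PowerSeries.coeff k G) * z ^ k‖ ≤ δ₁ := by
    by_cases hne : (Finset.Ioo 0 (lam G)).Nonempty
    · obtain ⟨k₁, hk₁, hmax⟩ := Finset.exists_max_image (Finset.Ioo 0 (lam G))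
        (fun k ↦ ‖ιZ (PowerSeries.coeff k G) * z ^ k‖) hne
      rw [Finset.mem_Ioo] at hk₁
      exact ⟨_, hfin k₁ hk₁.1 hk₁.2, norm_nonneg _,
        fun k hk0 hk ↦ hmax k (Finset.mem_Ioo.mpr ⟨hk0, hk⟩)⟩
    · refine ⟨0, hcpos, le_rfl, fun k hk0 hk ↦ ?_⟩
      exact absurd ⟨k, Finset.mem_Ioo.mpr ⟨hk0, hk⟩⟩ hne
  set δ : ℝ := max δ₁ (s ^ lam G) with hδ
  have hδlt : δ < c := max_lt hδ₁lt hlt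
  have hδ0 : 0 ≤ δ := le_trans hδ₁0 (le_max_left _ _)
  rw [← hbot]
  refine norm_tsum_eq_of_dominant G hz 0 hδ0 (by rw [hbot]; exact hδlt) fun k hk ↦ ?_
  have hkpos : 0 < k := Nat.pos_of_ne_zero hk
  by_cases hkl : k < lam G
  · exact le_trans (hδ₁ k hkpos hkl) (le_max_left _ _)
  · rw [not_lt] at hkl
    rw [norm_mul, norm_pow]
    calc ‖ιZ (PowerSeries.coeff k G)‖ * s ^ k ≤ 1 * s ^ lam G :=
          mul_le_mul (norm_algebraMap_coeff_le_one G k) (pow_le_pow_of_le_one hs0 hz.le hkl)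
            (pow_nonneg hs0 _) zero_le_one
      _ = s ^ lam G := one_mul _
      _ ≤ δ := le_max_right _ _

/-- **THE ONE-SEGMENT NEWTON POLYGON.** For `G ∈ Λ ∖ {0}` with `μ(G) = 0` whose coefficients below
`λ(G)` satisfy the chord condition `|G_k|^{λ} ≤ |G_0|^{λ−k}` (`0 < k < λ`), every zero `z` of `G` in the
open unit disc of `ℂ_p` has **`|z|^{λ(G)} = |G_0|`** — all `λ(G)` roots have valuation `v(G_0)/λ(G)`.
[cite: Koblitz1984, Ch. IV §4 (Newton polygon of a power series)] [cite: Washington1997, §7.1–7.2 and Thm. 7.3] -/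
theorem norm_pow_lam_eq_of_hasSum_zero_of_chord {G : IwasawaAlgebra p} (hG0 : G ≠ 0) (hμ : mu G = 0)
    (hchord : ∀ k, 0 < k → k < lam G →
      ‖PowerSeries.coeff k G‖ ^ lam G ≤ ‖PowerSeries.constantCoeff G‖ ^ (lam G - k))
    {z : ℂ_[p]} (hz : ‖z‖ < 1)
    (hsum : HasSum (fun k ↦ ((algebraMap ℚ_[p] ℂ_[p]).comp (algebraMap ℤ_[p] ℚ_[p]))
      (PowerSeries.coeff k G) * z ^ k) 0) :
    ‖z‖ ^ lam G = ‖PowerSeries.constantCoeff G‖ := by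
  have hval : ‖∑' k, ((algebraMap ℚ_[p] ℂ_[p]).comp (algebraMap ℤ_[p] ℚ_[p]))
      (PowerSeries.coeff k G) * z ^ k‖ = 0 := by rw [hsum.tsum_eq, norm_zero]
  rcases lt_trichotomy (‖z‖ ^ lam G) ‖PowerSeries.constantCoeff G‖ with hlt | heq | hgt
  · rw [norm_tsum_eq_norm_constantCoeff_of_chord hchord hz hlt] at hval
    exact absurd hval (lt_of_le_of_lt (pow_nonneg (norm_nonneg _) _) hlt).ne'
  · exact heq
  · rw [norm_tsum_eq_pow_lam_of_chord hG0 hμ hchord hz hgt] at hval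
    exact absurd hval (lt_of_le_of_lt (norm_nonneg _) hgt).ne'

end Chord

/-! ## §3. Two functions: slope separation and coprimality under the chord condition -/

section TwoFunctions

/-- **Slope separation (general leading valuation).** `F, G ∈ Λ ∖ {0}`, `μ = 0`, chord conditions,
NONZERO constant terms with `|F_0|^{λ(G)} ≠ |G_0|^{λ(F)}` (different slopes): no common zero in the open
unit disc of `ℂ_p` — it would have `|z|^{λ(F)λ(G)} = |F_0|^{λ(G)} = |G_0|^{λ(F)}`.
[cite: Koblitz1984, Ch. IV §4 (Newton polygon of a power series)] [cite: Washington1997, §7.1–7.2 and Thm. 7.3] -/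
theorem not_common_zero_of_chord {F G : IwasawaAlgebra p} (hF0 : F ≠ 0) (hG0 : G ≠ 0)
    (hμF : mu F = 0) (hμG : mu G = 0)
    (hchF : ∀ k, 0 < k → k < lam F →
      ‖PowerSeries.coeff k F‖ ^ lam F ≤ ‖PowerSeries.constantCoeff F‖ ^ (lam F - k))
    (hchG : ∀ k, 0 < k → k < lam G →
      ‖PowerSeries.coeff k G‖ ^ lam G ≤ ‖PowerSeries.constantCoeff G‖ ^ (lam G - k))
    (hsep : ‖PowerSeries.constantCoeff F‖ ^ lam G ≠ ‖PowerSeries.constantCoeff G‖ ^ lam F)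
    {z : ℂ_[p]} (hz : ‖z‖ < 1)
    (hFz : HasSum (fun k ↦ ((algebraMap ℚ_[p] ℂ_[p]).comp (algebraMap ℤ_[p] ℚ_[p]))
      (PowerSeries.coeff k F) * z ^ k) 0)
    (hGz : HasSum (fun k ↦ ((algebraMap ℚ_[p] ℂ_[p]).comp (algebraMap ℤ_[p] ℚ_[p]))
      (PowerSeries.coeff k G) * z ^ k) 0) : False := by
  have hF' := norm_pow_lam_eq_of_hasSum_zero_of_chord hF0 hμF hchF hz hFz
  have hG' := norm_pow_lam_eq_of_hasSum_zero_of_chord hG0 hμG hchG hz hGz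
  apply hsep
  rw [← hF', ← hG', ← pow_mul, ← pow_mul, mul_comm]

/-- **NO COMMON HEIGHT-ONE PRIME (general leading valuation).** `F, G ∈ Λ ∖ {0}`, `μ(F) = μ(G) = 0`, chord
conditions, nonzero constant terms with `|F_0|^{λ(G)} ≠ |G_0|^{λ(F)}`: no height-one prime of
`Λ = ℤ_p⟦T⟧` contains both (`(p)` by `μ(F) = 0`; `(f)`, `f` distinguished irreducible, by its common zero
in `ℂ_p`). [cite: Washington1997, §7.1–7.2, Thm. 7.3 and §13.2] [cite: Koblitz1984, Ch. IV §4 (Newton polygon of a power series)] -/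
theorem not_mem_and_mem_of_chord {F G : IwasawaAlgebra p} (hF0 : F ≠ 0) (hG0 : G ≠ 0)
    (hμF : mu F = 0) (hμG : mu G = 0)
    (hchF : ∀ k, 0 < k → k < lam F →
      ‖PowerSeries.coeff k F‖ ^ lam F ≤ ‖PowerSeries.constantCoeff F‖ ^ (lam F - k))
    (hchG : ∀ k, 0 < k → k < lam G →
      ‖PowerSeries.coeff k G‖ ^ lam G ≤ ‖PowerSeries.constantCoeff G‖ ^ (lam G - k))
    (hsep : ‖PowerSeries.constantCoeff F‖ ^ lam G ≠ ‖PowerSeries.constantCoeff G‖ ^ lam F)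
    (𝔭 : PrimeSpectrum (IwasawaAlgebra p)) (h𝔭 : 𝔭.asIdeal.height = 1) :
    ¬ (F ∈ 𝔭.asIdeal ∧ G ∈ 𝔭.asIdeal) := by
  rintro ⟨hF𝔭, hG𝔭⟩
  rcases IwasawaAlgebra.eq_span_of_height_eq_one p 𝔭.asIdeal h𝔭 with hp𝔭 | ⟨f, hf, hirr, hf𝔭⟩
  · rw [hp𝔭, Ideal.mem_span_singleton] at hF𝔭
    have h1 : 1 ≤ mu F := le_mu_of_C_pow_dvd hF0 (by rwa [pow_one])
    omega
  · obtain ⟨z, hz, hzero⟩ := exists_common_zero_of_span_distinguished hf hirr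
    rw [hf𝔭] at hF𝔭 hG𝔭
    exact not_common_zero_of_chord hF0 hG0 hμF hμG hchF hchG hsep hz (hzero F hF𝔭) (hzero G hG𝔭)

/-- **The `T`-shifted form.** If `F = T·F₁`, `G = T·G₁` with `F₁, G₁` as in `not_mem_and_mem_of_chord`,
no height-one prime other than `(T)` contains both `F` and `G`. [cite: Washington1997, §7.1–7.2, Thm. 7.3 and §13.2] -/
theorem not_mem_and_mem_of_X_mul_of_chord {F G F₁ G₁ : IwasawaAlgebra p}
    (hFF : F = PowerSeries.X * F₁) (hGG : G = PowerSeries.X * G₁) (hF0 : F₁ ≠ 0) (hG0 : G₁ ≠ 0)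
    (hμF : mu F₁ = 0) (hμG : mu G₁ = 0)
    (hchF : ∀ k, 0 < k → k < lam F₁ →
      ‖PowerSeries.coeff k F₁‖ ^ lam F₁ ≤ ‖PowerSeries.constantCoeff F₁‖ ^ (lam F₁ - k))
    (hchG : ∀ k, 0 < k → k < lam G₁ →
      ‖PowerSeries.coeff k G₁‖ ^ lam G₁ ≤ ‖PowerSeries.constantCoeff G₁‖ ^ (lam G₁ - k))
    (hsep : ‖PowerSeries.constantCoeff F₁‖ ^ lam G₁ ≠ ‖PowerSeries.constantCoeff G₁‖ ^ lam F₁)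
    (𝔭 : PrimeSpectrum (IwasawaAlgebra p)) (h𝔭 : 𝔭.asIdeal.height = 1)
    (hT : (PowerSeries.X : IwasawaAlgebra p) ∉ 𝔭.asIdeal) :
    ¬ (F ∈ 𝔭.asIdeal ∧ G ∈ 𝔭.asIdeal) := by
  rintro ⟨hF𝔭, hG𝔭⟩
  rw [hFF] at hF𝔭
  rw [hGG] at hG𝔭
  exact not_mem_and_mem_of_chord hF0 hG0 hμF hμG hchF hchG hsep 𝔭 h𝔭
    ⟨(𝔭.isPrime.mem_or_mem hF𝔭).resolve_left hT, (𝔭.isPrime.mem_or_mem hG𝔭).resolve_left hT⟩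

/-- **The chord condition is automatic at leading valuation one**: if `μ(G) = 0` and `|G_0| = 1/p`
then `|G_k|^{λ} ≤ (1/p)^{λ} ≤ (1/p)^{λ−k}` for `0 < k < λ` (all those coefficients lie in `pℤ_p`) — so
`…SlopeSeparation.lean` §2–§4 is the case `v(G_0) = 1` of this file. [cite: Washington1997, §7.1] -/
theorem chord_of_norm_constantCoeff_eq_inv {G : IwasawaAlgebra p} (hG0 : G ≠ 0) (hμ : mu G = 0)
    (h0 : ‖PowerSeries.constantCoeff G‖ = (p : ℝ)⁻¹) :
    ∀ k, 0 < k → k < lam G →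
      ‖PowerSeries.coeff k G‖ ^ lam G ≤ ‖PowerSeries.constantCoeff G‖ ^ (lam G - k) := by
  intro k hk0 hk
  obtain ⟨hq0, hq1⟩ := inv_prime_pos_and_lt_one (p := p)
  have hck : ‖PowerSeries.coeff k G‖ ≤ (p : ℝ)⁻¹ := by
    rw [← norm_algebraMap_comp_apply]; exact norm_coeff_le_inv_of_lt_lam hG0 hμ hk
  rw [h0]
  calc ‖PowerSeries.coeff k G‖ ^ lam G ≤ ((p : ℝ)⁻¹) ^ lam G :=
        pow_le_pow_left₀ (norm_nonneg _) hck _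
    _ ≤ ((p : ℝ)⁻¹) ^ (lam G - k) := pow_le_pow_of_le_one hq0.le hq1.le (Nat.sub_le _ _)

end TwoFunctions

end Summit.BirchSwinnertonDyer.BirchSwinnertonDyer.Theorems.ChromaticSlopeSeparation

end
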